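import Summits.NavierStokesRegularity.FluidComputer.ClayEvolutionPieces
import Literature.Analysis.FluidPDE.ClassicalSolutionGlue
import HarnessLib

/-!
# The finite-energy classical evolution of Clay data with a Clay force, II: the glued evolution

Cell `ns-blowup`, seat `ns-blowup-ecbridge-2` (g5; the E–C endpoint theory seat). LABEL: E–C typing
(KERNEL — no named fact). WHAT THIS IS NOT: not Navier–Stokes evidence — the union of all
finite-energy classical pieces of the forced evolution of GIVEN data is a classical solution on its
time domain; no blow-up is constructed or asserted. Companion memo:
`run/shared/lean/pub/ns-blowup/ecbridge2/ECBRIDGE-2-MEMO-4.md`.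

## Content

With `Piece ν f u₀` from `ClayEvolutionPieces.lean` (finite-energy classical solutions on closed
slabs `[0, τ]` from `u₀`; any two agree on their common slab):

* `dom ν f u₀ = {t ≥ 0 | ∃ piece, t < τ}` — the time domain of the evolution;
* `sel P₁ t` — a piece whose slab reaches beyond `max t P₁.τ` if there is one, else the anchor `P₁`
  (so the selection is CONSTANT for `t < P₁.τ`, which handles `t = 0`);
* `glueU P₁ t := (sel P₁ t).v t`, `glueP P₁ t := (sel P₁ t).q t − (sel P₁ t).q t 0` — the glued
  velocity and the pressure in the gauge `p(t, 0) = 0` (as in `IsClassicalNSSolutionOn.glue`);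
* `glueU_eq` — the glued velocity IS every piece on that piece's slab (uniqueness); `glueP_eq` — the
  glued pressure is every piece's gauged pressure at interior times
  (`IsClassicalNSSolutionOn.pressure_sub_apply_zero_eq_of_eventuallyEq`);
* **`isClassicalNSSolutionOn_glue`** — `(glueU, glueP)` is a classical solution of the forced system on
  `dom` (joint smoothness is local; the momentum equation at `t` is that of a piece reaching past `t`);
* `dom_eq_Ici` / `dom_eq_Ico_sSup` — `dom = [0, ∞)` if the slab lengths are unbounded, else
  `dom = [0, T*)` with `T* = sup τ`;
* `glueU_zero`, `glueU_energy_le` — datum `u₀` and ONE energy bound on the whole domain.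

References: J. T. Beale, T. Kato, A. Majda, Comm. Math. Phys. 94 (1984) §1 (maximal interval of
smooth existence) [cite: BealeKatoMajda1984, §1]; J. Leray, Acta Math. 63 (1934), §32
[cite: Leray1934, §32]; T. Tao, Anal. PDE 6 (2013), Cor. 11.4 [cite: Tao2011, Cor. 11.4].
-/

noncomputable section

namespace Summit.NavierStokesRegularity.FluidComputer

open Set MeasureTheory Filter Topology Function
open scoped ENNReal ContDiff NNReal
open Literature.Analysis.FluidPDE
open Summit.NavierStokesRegularity.NavierStokesRegularity
open Summit.NavierStokesRegularity.FluidComputer.PalasekTowerClayBridge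

namespace ClayEvolution

variable {ν : ℝ} {f : ℝ → EuclideanSpace ℝ (Fin 3) → EuclideanSpace ℝ (Fin 3)}
  {u₀ : EuclideanSpace ℝ (Fin 3) → EuclideanSpace ℝ (Fin 3)}

/-! ## §1 The time domain and the selection of pieces -/

variable (ν f u₀) in
/-- **The time domain of the finite-energy classical evolution**: the times `t ≥ 0` lying strictly
before the end of SOME piece. [cite: BealeKatoMajda1984, §1] -/
def dom : Set ℝ := {t | 0 ≤ t ∧ ∃ P : Piece ν f u₀, t < P.τ}

/-- The slab `[0, τ)` of a piece lies in the domain. [folklore] -/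
theorem Ico_subset_dom (P : Piece ν f u₀) : Ico 0 P.τ ⊆ dom ν f u₀ := fun _ ht => ⟨ht.1, P, ht.2⟩

/-- Times of the domain are nonnegative. [folklore] -/
theorem nonneg_of_mem_dom {t : ℝ} (ht : t ∈ dom ν f u₀) : 0 ≤ t := ht.1

/-- The part of the domain below the anchor's slab length is `[0, P₁.τ)`. [folklore] -/
theorem dom_inter_Iio (P₁ : Piece ν f u₀) : dom ν f u₀ ∩ Iio P₁.τ = Ico 0 P₁.τ := by
  ext t
  exact ⟨fun h => ⟨h.1.1, h.2⟩, fun h => ⟨Ico_subset_dom P₁ h, h.2⟩⟩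

open Classical in
/-- **Selection of a piece at time `t`** (anchor `P₁`): a piece whose slab reaches strictly beyond
`max t P₁.τ` if there is one, else `P₁` itself. [folklore] -/
def sel (P₁ : Piece ν f u₀) (t : ℝ) : Piece ν f u₀ :=
  if h : ∃ P : Piece ν f u₀, max t P₁.τ < P.τ then h.choose else P₁

/-- The selection is constant below the anchor's slab length: `sel P₁ t = sel P₁ 0` for
`t < P₁.τ`. [folklore] -/
theorem sel_eq_sel_zero (P₁ : Piece ν f u₀) {t : ℝ} (ht : t < P₁.τ) : sel P₁ t = sel P₁ 0 := by
  have h1 : max t P₁.τ = P₁.τ := max_eq_right ht.le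
  have h2 : max 0 P₁.τ = P₁.τ := max_eq_right P₁.τ_pos.le
  unfold sel
  rw [h1, h2]

/-- The anchor's slab lies inside the slab selected at time `0`: `P₁.τ ≤ (sel P₁ 0).τ`. [folklore] -/
theorem τ_le_sel_zero (P₁ : Piece ν f u₀) : P₁.τ ≤ (sel P₁ 0).τ := by
  unfold sel
  split_ifs with h
  · have := h.choose_spec
    exact ((le_max_right 0 P₁.τ).trans_lt this).le
  · exact le_rfl

/-- **The selected piece reaches past `t`** for every `t` in the domain. [folklore] -/
theorem lt_sel_τ (P₁ : Piece ν f u₀) {t : ℝ} (ht : t ∈ dom ν f u₀) : t < (sel P₁ t).τ := by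
  unfold sel
  split_ifs with h
  · exact (le_max_left t P₁.τ).trans_lt h.choose_spec
  · obtain ⟨-, P, hP⟩ := ht
    by_contra hle
    exact h ⟨P, by rw [max_eq_left (not_lt.1 hle)]; exact hP⟩

/-! ## §2 The glued fields -/

/-- **The glued velocity**: at time `t`, the velocity of the piece selected at `t`. [folklore] -/
def glueU (P₁ : Piece ν f u₀) (t : ℝ) : EuclideanSpace ℝ (Fin 3) → EuclideanSpace ℝ (Fin 3) :=
  (sel P₁ t).v t

/-- **The glued pressure** in the gauge `p(t, 0) = 0`: at time `t`, the gauged pressure of the piece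
selected at `t`. [folklore] -/
def glueP (P₁ : Piece ν f u₀) (t : ℝ) : EuclideanSpace ℝ (Fin 3) → ℝ :=
  fun x => (sel P₁ t).q t x - (sel P₁ t).q t 0

/-- The glued velocity takes the datum at `t = 0`. [folklore] -/
theorem glueU_zero (P₁ : Piece ν f u₀) : glueU P₁ 0 = u₀ := (sel P₁ 0).initial

section Uniqueness

variable (hν : 0 < ν) (hs : IsSmoothOnHalfSpace f) (hd : HasRapidSpaceTimeDecay f)
  (hC1 : ContDiff ℝ 1 u₀) (hdec : HasRapidSpatialDecay u₀)
include hν hs hd hC1 hdec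

/-- **The glued velocity IS every piece on that piece's slab** `[0, τ)` (uniqueness of pieces).
[cite: Tao2011, Cor. 11.4] -/
theorem glueU_eq (P₁ P : Piece ν f u₀) {t : ℝ} (ht : t ∈ Ico 0 P.τ) : glueU P₁ t = P.v t :=
  Piece.eq_of_le hν hs hd hC1 hdec (sel P₁ t) P ht.1 (lt_sel_τ P₁ (Ico_subset_dom P ht)).le ht.2.le

/-- Near an interior time `t` of a piece's slab the selected piece's velocity agrees with the piece's.
[cite: Tao2011, Cor. 11.4] -/
theorem sel_v_eventuallyEq (P₁ P : Piece ν f u₀) {t : ℝ} (ht : t ∈ dom ν f u₀) (ht0 : 0 < t)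
    (htP : t < P.τ) : ∀ᶠ τ in 𝓝 t, (sel P₁ t).v τ = P.v τ := by
  have hm : t < min (sel P₁ t).τ P.τ := lt_min (lt_sel_τ P₁ ht) htP
  filter_upwards [Ioo_mem_nhds ht0 hm] with τ hτ
  exact Piece.eq_of_le hν hs hd hC1 hdec (sel P₁ t) P hτ.1.le (hτ.2.le.trans (min_le_left _ _))
    (hτ.2.le.trans (min_le_right _ _))

/-- **The glued pressure is every piece's gauged pressure at interior times** `0 < t < τ`.
[folklore] -/
theorem glueP_eq (P₁ P : Piece ν f u₀) {t : ℝ} (ht : t ∈ Ioo 0 P.τ) (x : EuclideanSpace ℝ (Fin 3)) :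
    glueP P₁ t x = P.q t x - P.q t 0 := by
  have htd : t ∈ dom ν f u₀ := Ico_subset_dom P ⟨ht.1.le, ht.2⟩
  exact (sel P₁ t).classical.pressure_sub_apply_zero_eq_of_eventuallyEq P.classical
    (Icc_mem_nhds ht.1 (lt_sel_τ P₁ htd)) (Icc_mem_nhds ht.1 ht.2)
    (sel_v_eventuallyEq hν hs hd hC1 hdec P₁ P htd ht.1 ht.2) x

/-! ## §3 The glued evolution is a classical solution on its domain -/

/-- **THE GLUED EVOLUTION IS A CLASSICAL SOLUTION of the forced system on its time domain.** Joint
smoothness is local: near a time `t` of the domain the glued velocity coincides with the velocity of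
the piece selected at `t` on the relatively open set `{t' < (sel t).τ}` (uniqueness), and the glued
pressure with that piece's gauged pressure (for `t ≥ P₁.τ`, on the open set `(0, (sel t).τ)`; for
`t < P₁.τ` the selection is constant); the momentum equation at `t` is the selected piece's (one-sided
time derivatives within sets that coincide near `t`). [cite: BealeKatoMajda1984, §1] -/
theorem isClassicalNSSolutionOn_glue (P₁ : Piece ν f u₀) :
    IsClassicalNSSolutionOn (dom ν f u₀) ν f (glueU P₁) (glueP P₁) := by
  have hτ₁ := P₁.τ_pos
  set Q := sel P₁ 0 with hQ
  have hQτ : P₁.τ ≤ Q.τ := τ_le_sel_zero P₁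
  -- below `P₁.τ` everything is the fixed piece `Q`
  have hUlow : ∀ t, t < P₁.τ → glueU P₁ t = Q.v t := fun t ht => by
    simp only [glueU, sel_eq_sel_zero P₁ ht, hQ]
  have hPlow : ∀ t, t < P₁.τ → glueP P₁ t = fun x => Q.q t x - Q.q t 0 := fun t ht => by
    funext x; simp only [glueP, sel_eq_sel_zero P₁ ht, hQ]
  refine ⟨?_, ?_, ?_, ?_⟩
  · -- smoothness of the glued velocity
    refine contDiffOn_of_locally_contDiffOn fun z hz => ?_
    obtain ⟨t, x⟩ := z
    have ht : t ∈ dom ν f u₀ := hz.1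
    set P := sel P₁ t with hP
    have htP : t < P.τ := lt_sel_τ P₁ ht
    refine ⟨Iio P.τ ×ˢ univ, isOpen_Iio.prod isOpen_univ, ⟨htP, mem_univ _⟩, ?_⟩
    have hsub : (dom ν f u₀ ×ˢ (univ : Set (EuclideanSpace ℝ (Fin 3)))) ∩ Iio P.τ ×ˢ univ ⊆
        Icc 0 P.τ ×ˢ univ := by
      rintro ⟨s, y⟩ ⟨hs1, hs2⟩
      exact ⟨⟨hs1.1.1, (show s < P.τ from hs2.1).le⟩, mem_univ _⟩
    refine (ContDiffOn.mono P.classical.smooth_velocity hsub).congr fun z hz' => ?_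
    obtain ⟨s, y⟩ := z
    have hs0 : 0 ≤ s := hz'.1.1.1
    have hsP : s < P.τ := hz'.2.1
    simp only [uncurry_apply_pair, glueU_eq hν hs hd hC1 hdec P₁ P ⟨hs0, hsP⟩]
  · -- smoothness of the glued pressure
    refine contDiffOn_of_locally_contDiffOn fun z hz => ?_
    obtain ⟨t, x⟩ := z
    have ht : t ∈ dom ν f u₀ := hz.1
    by_cases htlow : t < P₁.τ
    · refine ⟨Iio P₁.τ ×ˢ univ, isOpen_Iio.prod isOpen_univ, ⟨htlow, mem_univ _⟩, ?_⟩
      have hsub : (dom ν f u₀ ×ˢ (univ : Set (EuclideanSpace ℝ (Fin 3)))) ∩ Iio P₁.τ ×ˢ univ ⊆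
          Icc 0 Q.τ ×ˢ univ := by
        rintro ⟨s, y⟩ ⟨hs1, hs2⟩
        exact ⟨⟨hs1.1.1, (show s < P₁.τ from hs2.1).le.trans hQτ⟩, mem_univ _⟩
      refine (ContDiffOn.mono Q.classical.smooth_pressure.sub_apply_zero hsub).congr fun z hz' => ?_
      obtain ⟨s, y⟩ := z
      have hsP : s < P₁.τ := hz'.2.1
      simp only [uncurry_apply_pair, hPlow s hsP]
    · have ht0 : 0 < t := hτ₁.trans_le (not_lt.1 htlow)
      set P := sel P₁ t with hP
      have htP : t < P.τ := lt_sel_τ P₁ ht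
      refine ⟨Ioo 0 P.τ ×ˢ univ, isOpen_Ioo.prod isOpen_univ, ⟨⟨ht0, htP⟩, mem_univ _⟩, ?_⟩
      have hsub : (dom ν f u₀ ×ˢ (univ : Set (EuclideanSpace ℝ (Fin 3)))) ∩ Ioo 0 P.τ ×ˢ univ ⊆
          Icc 0 P.τ ×ˢ univ := by
        rintro ⟨s, y⟩ ⟨-, hs2⟩
        exact ⟨Ioo_subset_Icc_self hs2.1, mem_univ _⟩
      refine (ContDiffOn.mono P.classical.smooth_pressure.sub_apply_zero hsub).congr fun z hz' => ?_
      obtain ⟨s, y⟩ := z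
      have hsI : s ∈ Ioo 0 P.τ := hz'.2.1
      simp only [uncurry_apply_pair, glueP_eq hν hs hd hC1 hdec P₁ P hsI]
  · -- the momentum equation
    intro t ht x
    by_cases htlow : t < P₁.τ
    · -- near `t` the glued fields are those of `Q`; the time sets coincide near `t`
      have hev : (fun τ => glueU P₁ τ x) =ᶠ[𝓝 t] fun τ => Q.v τ x := by
        filter_upwards [Iio_mem_nhds htlow] with τ hτ
        rw [hUlow τ hτ]
      have hI : Icc 0 Q.τ ∩ Iio P₁.τ = Ico 0 P₁.τ := by
        ext s
        simp only [mem_inter_iff, mem_Icc, mem_Iio, mem_Ico]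
        exact ⟨fun h => ⟨h.1.1, h.2⟩, fun h => ⟨⟨h.1, h.2.le.trans hQτ⟩, h.2⟩⟩
      have hD : timeDerivWithin (dom ν f u₀) (glueU P₁) t x = timeDerivWithin (Icc 0 Q.τ) Q.v t x := by
        simp only [timeDerivWithin_apply]
        rw [(hev.filter_mono nhdsWithin_le_nhds).derivWithin_eq (by rw [hUlow t htlow]),
          ← derivWithin_inter (Iio_mem_nhds htlow), dom_inter_Iio P₁, ← hI,
          derivWithin_inter (Iio_mem_nhds htlow)]
      rw [hD, hUlow t htlow, hPlow t htlow, gradient_sub_const]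
      exact Q.classical.momentum t ⟨ht.1, htlow.le.trans hQτ⟩ x
    · have ht0 : 0 < t := hτ₁.trans_le (not_lt.1 htlow)
      set P := sel P₁ t with hP
      have htP : t < P.τ := lt_sel_τ P₁ ht
      have hev : (fun τ => glueU P₁ τ x) =ᶠ[𝓝 t] fun τ => P.v τ x := by
        filter_upwards [Ioo_mem_nhds ht0 htP] with τ hτ
        rw [glueU_eq hν hs hd hC1 hdec P₁ P ⟨hτ.1.le, hτ.2⟩]
      have hdomN : dom ν f u₀ ∈ 𝓝 t :=
        mem_of_superset (Ioo_mem_nhds ht0 htP) fun s hs' => Ico_subset_dom P ⟨hs'.1.le, hs'.2⟩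
      have hD : timeDerivWithin (dom ν f u₀) (glueU P₁) t x = timeDerivWithin (Icc 0 P.τ) P.v t x := by
        simp only [timeDerivWithin_apply]
        rw [derivWithin_of_mem_nhds hdomN, derivWithin_of_mem_nhds (Icc_mem_nhds ht0 htP)]
        exact hev.deriv_eq
      have hUt : glueU P₁ t = P.v t := glueU_eq hν hs hd hC1 hdec P₁ P ⟨ht0.le, htP⟩
      have hPt : glueP P₁ t = fun y => P.q t y - P.q t 0 := by
        funext y; exact glueP_eq hν hs hd hC1 hdec P₁ P ⟨ht0, htP⟩ y
      rw [hD, hUt, hPt, gradient_sub_const]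
      exact P.classical.momentum t ⟨ht0.le, htP.le⟩ x
  · -- incompressibility
    intro t ht
    exact (sel P₁ t).classical.divFree t ⟨ht.1, (lt_sel_τ P₁ ht).le⟩

end Uniqueness

/-! ## §4 The shape of the domain, and the energy of the glued evolution -/

/-- **Unbounded slab lengths: the domain is the whole half-line** `[0, ∞)`. [folklore] -/
theorem dom_eq_Ici (h : ∀ T : ℝ, ∃ P : Piece ν f u₀, T < P.τ) : dom ν f u₀ = Ici 0 := by
  ext t
  exact ⟨fun ht => ht.1, fun ht => ⟨ht, h t⟩⟩

/-- **Bounded slab lengths: the domain is `[0, T*)` with `T* = sup τ`.** [folklore] -/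
theorem dom_eq_Ico_sSup [Nonempty (Piece ν f u₀)] (hb : BddAbove (range (Piece.τ (ν := ν) (f := f) (u₀ := u₀)))) :
    dom ν f u₀ = Ico 0 (sSup (range (Piece.τ (ν := ν) (f := f) (u₀ := u₀)))) := by
  ext t
  constructor
  · rintro ⟨ht0, P, hP⟩
    exact ⟨ht0, hP.trans_le (le_csSup hb ⟨P, rfl⟩)⟩
  · rintro ⟨ht0, ht⟩
    obtain ⟨_, ⟨P, rfl⟩, hP⟩ := exists_lt_of_lt_csSup (range_nonempty _) ht
    exact ⟨ht0, P, hP⟩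

/-- The supremum of the slab lengths is positive (bounded case). [folklore] -/
theorem sSup_τ_pos (P₁ : Piece ν f u₀) (hb : BddAbove (range (Piece.τ (ν := ν) (f := f) (u₀ := u₀)))) :
    0 < sSup (range (Piece.τ (ν := ν) (f := f) (u₀ := u₀))) :=
  P₁.τ_pos.trans_le (le_csSup hb ⟨P₁, rfl⟩)

/-- **ONE energy bound for the glued evolution on its whole domain** (`ν > 0`, Clay datum, Clay
force): `∫ |glueU(t)|² ≤ E` for every `t ∈ dom`, `E` the uniform bound of the pieces
(`Piece.energy_le_uniform`). [cite: Tao2011, Lemma 8.1] -/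
theorem glueU_energy_le (hν : 0 < ν) (hdec : HasRapidSpatialDecay u₀) (hs : IsSmoothOnHalfSpace f)
    (hd : HasRapidSpaceTimeDecay f) (P₁ : Piece ν f u₀) :
    ∃ E : ℝ≥0∞, E < ⊤ ∧ ∀ t ∈ dom ν f u₀, ∫⁻ x, ‖glueU P₁ t x‖ₑ ^ 2 ≤ E := by
  obtain ⟨E, hEt, hE⟩ := Piece.energy_le_uniform (u₀ := u₀) hν hdec hs hd
  exact ⟨E, hEt, fun t ht => hE (sel P₁ t) t ⟨ht.1, (lt_sel_τ P₁ ht).le⟩⟩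

/-- The energy of the glued evolution on a closed sub-slab `[0, T'']` lying before the end of some
piece. [folklore] -/
theorem glueU_energy_Icc (hν : 0 < ν) (hdec : HasRapidSpatialDecay u₀) (hs : IsSmoothOnHalfSpace f)
    (hd : HasRapidSpaceTimeDecay f) (P₁ P : Piece ν f u₀) {T'' : ℝ} (hT'' : T'' < P.τ) :
    ∃ C : ℝ≥0∞, C < ⊤ ∧ ∀ t ∈ Icc 0 T'', ∫⁻ x, ‖glueU P₁ t x‖ₑ ^ 2 ≤ C := by
  obtain ⟨E, hEt, hE⟩ := glueU_energy_le hν hdec hs hd P₁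
  exact ⟨E, hEt, fun t ht => hE t (Ico_subset_dom P ⟨ht.1, lt_of_le_of_lt ht.2 hT''⟩)⟩

end ClayEvolution

end Summit.NavierStokesRegularity.FluidComputer

end
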